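import Mathlib
import Summits.QuantumFields.YangMills.Theorems.RationalShortRootRigidityAlternationCore

/-!
# `RationalShortRootRigidity` — Step 4 (`stub_alternation`) assembly, part IV: local analysis of the axis-Stieltjes identity

Part of the ASSEMBLY of Step 4 of the paper proof of crux `stmt-QuantumFields-23124`
(`F4SubCurvatureDoor.RationalShortRootRigidity`, LINE g15-A of planner ym-idea-3; birth skeleton
HOME l15/RationalShortRootRigidity-birth.lean, stub `stub_alternation`; plan HOME l15/STUB-PLAN-Alternation.md §1 (ALT) and §0).

Fix a spatial momentum `q` and put `s = |q|²`.  In the shell picture (part II) the axis-Stieltjes identity of the crux reads, with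
`A(X) := E(X, q)` (the fibre polynomial) and a radial denominator `D₀(p) = R(p²)`:
`A(t² + s) = R(t² + s)·(c(t²) + Σⱼ rⱼ/(t² + ωⱼ²))` for all real `t` (`rⱼ ≥ 0`; positivity of the `ωⱼ` is not needed here).

**Theorem** (`local_analysis`).  Then
* (`poly_identity`) `A·W = R·V` in `ℝ[X]` with `W = ∏ⱼ (X − xⱼ)`, `xⱼ = s − ωⱼ²`, `V = c(X−s)W + Σⱼ rⱼ ∏_{i≠j}(X − xᵢ)`
  (both sides agree on the half-line `X > s`);
* (LA-1) at a NON-REAL complex root `z` of `R`: `A(z) = 0` (`W(z) ≠ 0` off the real axis);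
* (LA-2/3) at a REAL root `ρ` of `R`: `A(ρ) = R′(ρ)·r_J` with `r_J = Σ_{xⱼ = ρ} rⱼ ≥ 0` (continuity at `ρ` of
  `X ↦ (X − ρ)·(c(X−s) + Σ rⱼ/(X − xⱼ))` along the punctured neighbourhood filter); in particular `A(ρ)·R′(ρ) ≥ 0`
  (the SHELL SIGN, plan (ALT)) and `A(ρ) = 0` at a multiple root.

Mathlib + `Alternation.eval_fibre` (part I); THEOREMS ONLY; no named facts; no `sorry`; default heartbeats.  Nothing about the crux
23124, the route's rung or the Yang–Mills mass gap is proved here.  Free-hands width seat `ym-line-sfw-p2-w4` g18,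
`--supports stmt-QuantumFields-23124`.
-/

set_option autoImplicit false

namespace Summit.QuantumFields.YangMills.Theorems.RationalShortRootRigidity.Alternation

open scoped BigOperators Polynomial Topology
open Filter

/-! ### 1. The cleared polynomial identity on the fibre -/

/-- Pointwise: `W(y)·(c̃(y) + Σ rⱼ/(y − xⱼ)) = V(y)` off the poles. [folklore] -/
theorem eval_W_mul_sum {k : ℕ} (x r : Fin k → ℝ) (ct : ℝ[X]) (y : ℝ) (hy : ∀ j, y ≠ x j) :
    (∏ j, (y - x j)) * (ct.eval y + ∑ j, r j / (y - x j)) =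
      ct.eval y * (∏ j, (y - x j)) + ∑ j, r j * ∏ i ∈ Finset.univ.erase j, (y - x i) := by
  rw [mul_add, Finset.mul_sum]
  congr 1
  · ring
  · refine Finset.sum_congr rfl fun j _ => ?_
    rw [← Finset.mul_prod_erase Finset.univ (fun i => y - x i) (Finset.mem_univ j)]
    have hj : y - x j ≠ 0 := sub_ne_zero.2 (hy j)
    field_simp

/-- The cleared identity `A·W = R·V` in `ℝ[X]`, from the axis-Stieltjes identity on the half-line `X > s`. [folklore] -/
theorem poly_identity (A R c : ℝ[X]) (s : ℝ) {k : ℕ} (ω r : Fin k → ℝ)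
    (hid : ∀ t : ℝ, A.eval (t ^ 2 + s) = R.eval (t ^ 2 + s) * (c.eval (t ^ 2) + ∑ j, r j / (t ^ 2 + ω j ^ 2))) :
    A * ∏ j, (Polynomial.X - Polynomial.C (s - ω j ^ 2)) =
      R * (c.comp (Polynomial.X - Polynomial.C s) * ∏ j, (Polynomial.X - Polynomial.C (s - ω j ^ 2)) +
        ∑ j, Polynomial.C (r j) * ∏ i ∈ Finset.univ.erase j, (Polynomial.X - Polynomial.C (s - ω i ^ 2))) := by
  rw [← sub_eq_zero]
  apply Polynomial.eq_zero_of_infinite_isRoot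
  refine Set.Infinite.mono (s := Set.Ioi s) ?_ (Set.Ioi_infinite _)
  intro y hy
  rw [Set.mem_Ioi] at hy
  rw [Set.mem_setOf_eq, Polynomial.IsRoot.def, Polynomial.eval_sub, sub_eq_zero]
  have hyx : ∀ j, y ≠ s - ω j ^ 2 := by
    intro j
    have := sq_nonneg (ω j)
    intro h
    linarith
  -- `y = t² + s` with `t = √(y − s)`
  have hts : Real.sqrt (y - s) ^ 2 + s = y := by
    rw [Real.sq_sqrt (by linarith)]
    ring
  have ht2 : Real.sqrt (y - s) ^ 2 = y - s := Real.sq_sqrt (by linarith)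
  have h := hid (Real.sqrt (y - s))
  rw [hts, ht2] at h
  simp only [Polynomial.eval_mul, Polynomial.eval_prod, Polynomial.eval_sub, Polynomial.eval_X, Polynomial.eval_C,
    Polynomial.eval_add, Polynomial.eval_finsetSum, Polynomial.eval_comp]
  have hden : ∀ j, y - s + ω j ^ 2 = y - (s - ω j ^ 2) := fun j => by ring
  simp_rw [hden] at h
  rw [h, mul_assoc]
  congr 1
  rw [mul_comm]
  have key := eval_W_mul_sum (fun j => s - ω j ^ 2) r (c.comp (Polynomial.X - Polynomial.C s)) y hyx
  simp only [Polynomial.eval_comp, Polynomial.eval_sub, Polynomial.eval_X, Polynomial.eval_C] at key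
  exact key

/-! ### 2. The local analysis -/

/-- **Local analysis of the axis-Stieltjes identity** (plan (ALT) and §0).  See the module docstring. [folklore] -/
theorem local_analysis (E : MvPolynomial (Fin 4) ℝ) (R c : ℝ[X]) (q : Fin 3 → ℝ) {k : ℕ} (ω r : Fin k → ℝ)
    (hr : ∀ j, 0 ≤ r j)
    (hid : ∀ t : ℝ, MvPolynomial.eval (Fin.cons (t ^ 2 + ∑ i, q i ^ 2) q : Fin 4 → ℝ) E =
      R.eval (t ^ 2 + ∑ i, q i ^ 2) * (c.eval (t ^ 2) + ∑ j, r j / (t ^ 2 + ω j ^ 2))) :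
    (∀ z : ℂ, z.im ≠ 0 → Polynomial.aeval z R = 0 →
      Polynomial.aeval z (Polynomial.map (MvPolynomial.eval q) (MvPolynomial.finSuccEquiv ℝ 3 E)) = 0) ∧
    (∀ ρ : ℝ, R.eval ρ = 0 → ∃ rJ : ℝ, 0 ≤ rJ ∧
      MvPolynomial.eval (Fin.cons ρ q : Fin 4 → ℝ) E = R.derivative.eval ρ * rJ) := by
  classical
  set s : ℝ := ∑ i, q i ^ 2 with hs
  set A : ℝ[X] := Polynomial.map (MvPolynomial.eval q) (MvPolynomial.finSuccEquiv ℝ 3 E) with hA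
  set x : Fin k → ℝ := fun j => s - ω j ^ 2 with hx
  set ct : ℝ[X] := c.comp (Polynomial.X - Polynomial.C s) with hct
  set W : ℝ[X] := ∏ j, (Polynomial.X - Polynomial.C (s - ω j ^ 2)) with hW
  set V : ℝ[X] := ct * ∏ j, (Polynomial.X - Polynomial.C (s - ω j ^ 2)) +
    ∑ j, Polynomial.C (r j) * ∏ i ∈ Finset.univ.erase j, (Polynomial.X - Polynomial.C (s - ω i ^ 2)) with hV
  have hidA : ∀ t : ℝ, A.eval (t ^ 2 + s) = R.eval (t ^ 2 + s) * (c.eval (t ^ 2) + ∑ j, r j / (t ^ 2 + ω j ^ 2)) := by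
    intro t
    rw [hA, eval_fibre]
    exact hid t
  have hpoly : A * W = R * V := poly_identity A R c s ω r hidA
  refine ⟨?_, ?_⟩
  · -- (LA-1) non-real roots
    intro z hz hRz
    have h := congrArg (Polynomial.aeval z) hpoly
    rw [map_mul, map_mul, hRz, zero_mul, mul_eq_zero] at h
    rcases h with h | h
    · exact h
    · exfalso
      rw [hW, map_prod, Finset.prod_eq_zero_iff] at h
      obtain ⟨j, -, hj⟩ := h
      rw [map_sub, Polynomial.aeval_X, Polynomial.aeval_C, Complex.coe_algebraMap, sub_eq_zero] at hj
      apply hz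
      rw [hj, Complex.ofReal_im]
  · -- (LA-2/3) real roots
    intro ρ hρ
    -- `R = (X − ρ)·R₁`, `R₁(ρ) = R′(ρ)`
    set R₁ : ℝ[X] := R /ₘ (Polynomial.X - Polynomial.C ρ) with hR₁
    have hRfac : R = (Polynomial.X - Polynomial.C ρ) * R₁ :=
      (Polynomial.mul_divByMonic_eq_iff_isRoot.2 hρ).symm
    have hR₁ρ : R₁.eval ρ = R.derivative.eval ρ := by
      have h := congrArg (fun P : ℝ[X] => P.derivative.eval ρ) hRfac
      simp only [Polynomial.derivative_mul, Polynomial.derivative_X_sub_C, one_mul, Polynomial.eval_add,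
        Polynomial.eval_mul, Polynomial.eval_sub, Polynomial.eval_X, Polynomial.eval_C, sub_self, zero_mul,
        add_zero] at h
      exact h.symm
    -- the regularised function `g`
    set g : ℝ → ℝ := fun y => (y - ρ) * ct.eval y +
      ∑ j, (if x j = ρ then r j else r j * (y - ρ) / (y - x j)) with hg
    -- (A1)–(A2): off the poles and `ρ`, `A(y) = R₁(y)·g(y)`
    have hA2 : ∀ y : ℝ, y ≠ ρ → (∀ j, y ≠ x j) → A.eval y = R₁.eval y * g y := by
      intro y hyρ hyx
      have hWy : W.eval y = ∏ j, (y - x j) := by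
        rw [hW, Polynomial.eval_prod]
        simp only [Polynomial.eval_sub, Polynomial.eval_X, Polynomial.eval_C, hx]
      have hWne : W.eval y ≠ 0 := by
        rw [hWy, Finset.prod_ne_zero_iff]
        exact fun j _ => sub_ne_zero.2 (hyx j)
      have hVy : V.eval y = ct.eval y * (∏ j, (y - x j)) + ∑ j, r j * ∏ i ∈ Finset.univ.erase j, (y - x i) := by
        rw [hV]
        simp only [Polynomial.eval_add, Polynomial.eval_mul, Polynomial.eval_prod, Polynomial.eval_sub,
          Polynomial.eval_X, Polynomial.eval_C, Polynomial.eval_finsetSum, hx]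
      have h := congrArg (Polynomial.eval y) hpoly
      rw [Polynomial.eval_mul, Polynomial.eval_mul, hVy, ← eval_W_mul_sum x r ct y hyx, ← hWy] at h
      -- cancel `W(y)`
      have hAy : A.eval y = R.eval y * (ct.eval y + ∑ j, r j / (y - x j)) := by
        have : A.eval y * W.eval y = (R.eval y * (ct.eval y + ∑ j, r j / (y - x j))) * W.eval y := by
          rw [h]
          ring
        exact mul_right_cancel₀ hWne this
      rw [hAy, hRfac, Polynomial.eval_mul, Polynomial.eval_sub, Polynomial.eval_X, Polynomial.eval_C, hg]
      simp only
      rw [mul_comm (y - ρ) (R₁.eval y), mul_assoc, mul_add, Finset.mul_sum]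
      congr 1
      congr 1
      refine Finset.sum_congr rfl fun j _ => ?_
      split_ifs with hj
      · rw [hj]
        field_simp [sub_ne_zero.2 hyρ]
      · rw [mul_div_assoc', mul_comm (y - ρ) (r j)]
    -- (A3): eventually along the punctured neighbourhood
    have hev : ∀ᶠ y in 𝓝[≠] ρ, y ≠ ρ ∧ ∀ j, y ≠ x j := by
      have h1 : ∀ᶠ y in 𝓝[≠] ρ, y ≠ ρ := eventually_mem_nhdsWithin
      have h2 : ∀ j, ∀ᶠ y in 𝓝[≠] ρ, y ≠ x j := by
        intro j
        by_cases hj : x j = ρ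
        · rw [hj]
          exact h1
        · exact (eventually_ne_nhds (Ne.symm hj)).filter_mono nhdsWithin_le_nhds
      exact h1.and (eventually_all.2 h2)
    have hEq : (fun y => A.eval y) =ᶠ[𝓝[≠] ρ] (fun y => R₁.eval y * g y) :=
      hev.mono fun y hy => hA2 y hy.1 hy.2
    -- continuity of `g` at `ρ`
    have hgc : ContinuousAt g ρ := by
      have hterm : ∀ j, ContinuousAt (fun y : ℝ => if x j = ρ then r j else r j * (y - ρ) / (y - x j)) ρ := by
        intro j
        by_cases hj : x j = ρ
        · simp only [hj, ↓reduceIte]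
          exact continuousAt_const
        · simp only [hj, ↓reduceIte]
          exact ContinuousAt.div (continuousAt_const.mul (continuousAt_id.sub continuousAt_const))
            (continuousAt_id.sub continuousAt_const) (sub_ne_zero.2 (Ne.symm hj))
      have hsum : ContinuousAt (fun y : ℝ => ∑ j, (if x j = ρ then r j else r j * (y - ρ) / (y - x j))) ρ :=
        tendsto_finsetSum _ fun j _ => hterm j
      exact ((continuousAt_id.sub continuousAt_const).mul ct.continuousAt).add hsum
    have hgρ : g ρ = ∑ j, (if x j = ρ then r j else 0) := by
      rw [hg]
      simp only [sub_self, zero_mul, zero_add, mul_zero, zero_div]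
    have hlim1 : Tendsto (fun y => A.eval y) (𝓝[≠] ρ) (𝓝 (A.eval ρ)) :=
      A.continuousAt.tendsto.mono_left nhdsWithin_le_nhds
    have hlim2 : Tendsto (fun y => R₁.eval y * g y) (𝓝[≠] ρ) (𝓝 (R₁.eval ρ * g ρ)) :=
      (R₁.continuousAt.mul hgc).tendsto.mono_left nhdsWithin_le_nhds
    have hval : A.eval ρ = R₁.eval ρ * g ρ := tendsto_nhds_unique_of_eventuallyEq hlim1 hlim2 hEq
    refine ⟨∑ j, (if x j = ρ then r j else 0), Finset.sum_nonneg fun j _ => ?_, ?_⟩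
    · split_ifs
      · exact hr j
      · exact le_refl 0
    · rw [← eval_fibre, ← hA, hval, hR₁ρ, hgρ]

end Summit.QuantumFields.YangMills.Theorems.RationalShortRootRigidity.Alternation
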